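import Mathlib.Algebra.BigOperators.Field
import Mathlib.Algebra.BigOperators.Group.Finset.Basic
import Mathlib.Tactic.FieldSimp
import Mathlib.Tactic.Ring
import HarnessLib

/-!
# Monomials under a monoidal transform: the exponent bookkeeping of [CoP1] Prop. 8.1 (`E`, `F`)

Topic: `Literature/AlgebraicGeometry/Resolution`. PROOF side of `CossartPiltant2019ReductionP`
(`ArithmeticalThreefoldsLocal.lean`), input (C4), head of the decomposition layer = [CoP1]
Prop. 8.1 (`DecompositionLayerStrictParameters.lean`). In the proof of Prop. 8.1 (HAL
hal-00139124, pp. 22–23) the ideals `f S₂` and `m_{S₀} S₂` are MONOMIAL in a regular system of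
parameters `(y₁, y₂, y₃)`, with index sets `E ⊇ F` of the parameters dividing them, and one
follows these monomials through monoidal transforms at `(y_{i₁}, y_{i₂})` along the valuation:
in the chart `y_{i₂} = y_{i₁} · (y_{i₂}/y_{i₁})`,

> `E⁽¹⁾ ∖ F⁽¹⁾ = E ∖ (F ∪ {i₁})` … If `W y_{i₂} < W y_{i₁}` … we have `E⁽¹⁾ = E`, `F⁽¹⁾ = F`.

This file records the two elementary identities behind this bookkeeping, in a field `K`
(`z := x_b / x_a`): a monomial `∏ x_c^{α_c}` equals (1) the monomial in the updated family
`x_b ↦ z` with updated exponents `α_a ↦ α_a + α_b` (the case where `z` is a new regular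
parameter, `v(z) > 0`), and (2) `z^{α_b}` times the monomial in the old family with exponents
`α_a ↦ α_a + α_b`, `α_b ↦ 0` (the case where `z` is a unit of the transform, `v(z) = 0`).
With `MonoidalTransformCentre.lean` (the new regular system of parameters) and
`MonoidalTransformRegular.lean` (regularity) these are the bricks of the `E = F` reduction and
of Lemma 8.2.

Everything is PROVED; no named facts, definitions, instances or notation are introduced.

## Sources

* V. Cossart, O. Piltant, J. Algebra 320 (2008) 1051–1082: proof of Prop. 8.1 (HAL
  hal-00139124, pp. 22–23). [CossartPiltant2008]
-/

namespace Literature.AlgebraicGeometry.Resolution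

section Monomials

variable {ι : Type*} [Fintype ι] [DecidableEq ι] {K : Type*} [Field K]

/-- Splitting a finite product at two distinct indices. [folklore] -/
private theorem prod_eq_mul_mul_prod_erase_erase (g : ι → K) {a b : ι} (hab : a ≠ b) :
    ∏ c, g c = g a * (g b * ∏ c ∈ (Finset.univ.erase a).erase b, g c) := by
  rw [Finset.mul_prod_erase _ _ (Finset.mem_erase.mpr ⟨hab.symm, Finset.mem_univ b⟩),
    Finset.mul_prod_erase _ _ (Finset.mem_univ a)]

/-- **Monomials under a monoidal transform, new-parameter case** ([CoP1] proof of Prop. 8.1,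
HAL p. 23: in the chart `y_{i₂} = y_{i₁}·(y_{i₂}/y_{i₁})` with `y_{i₂}/y_{i₁}` a new regular
parameter, a monomial in `(y)` is the monomial in the new parameters with the exponent of
`y_{i₁}` increased by that of `y_{i₂}`): for `x_a ≠ 0` and `z = x_b/x_a`,
`∏ x_c^{α_c} = ∏ x′_c^{α′_c}` with `x′ = x[b ↦ z]`, `α′ = α[a ↦ α_a + α_b]`.
[cite: CossartPiltant2008, proof of Prop. 8.1 (HAL pp. 22–23)] -/
theorem prod_pow_eq_prod_update_div_pow_update (x : ι → K) (α : ι → ℕ) {a b : ι}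
    (hab : a ≠ b) (hxa : x a ≠ 0) :
    ∏ c, x c ^ α c =
      ∏ c, Function.update x b (x b / x a) c ^ Function.update α a (α a + α b) c := by
  rw [prod_eq_mul_mul_prod_erase_erase (fun c => x c ^ α c) hab,
    prod_eq_mul_mul_prod_erase_erase
      (fun c => Function.update x b (x b / x a) c ^ Function.update α a (α a + α b) c) hab]
  have hrest : ∏ c ∈ (Finset.univ.erase a).erase b,
      Function.update x b (x b / x a) c ^ Function.update α a (α a + α b) c =
      ∏ c ∈ (Finset.univ.erase a).erase b, x c ^ α c := by
    refine Finset.prod_congr rfl fun c hc => ?_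
    obtain ⟨hcb, hc'⟩ := Finset.mem_erase.mp hc
    obtain ⟨hca, -⟩ := Finset.mem_erase.mp hc'
    rw [Function.update_of_ne hcb, Function.update_of_ne hca]
  rw [hrest]
  simp only [Function.update_self, Function.update_of_ne hab, Function.update_of_ne hab.symm]
  rw [pow_add, div_pow]
  field_simp

/-- **Monomials under a monoidal transform, unit case** ([CoP1] proof of Prop. 8.1, HAL
p. 23: when `y_{i₂}/y_{i₁}` is a unit of the transform, `i₂` leaves `E` and `F` and the
exponent of `y_{i₁}` absorbs that of `y_{i₂}`): for `x_a ≠ 0` and `z = x_b/x_a`,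
`∏ x_c^{α_c} = z^{α_b} · ∏ x_c^{α″_c}` with `α″ = α[a ↦ α_a + α_b][b ↦ 0]`.
[cite: CossartPiltant2008, proof of Prop. 8.1 (HAL pp. 22–23)] -/
theorem prod_pow_eq_div_pow_mul_prod_pow_update (x : ι → K) (α : ι → ℕ) {a b : ι}
    (hab : a ≠ b) (hxa : x a ≠ 0) :
    ∏ c, x c ^ α c =
      (x b / x a) ^ α b *
        ∏ c, x c ^ Function.update (Function.update α a (α a + α b)) b 0 c := by
  rw [prod_eq_mul_mul_prod_erase_erase (fun c => x c ^ α c) hab,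
    prod_eq_mul_mul_prod_erase_erase
      (fun c => x c ^ Function.update (Function.update α a (α a + α b)) b 0 c) hab]
  have hrest : ∏ c ∈ (Finset.univ.erase a).erase b,
      x c ^ Function.update (Function.update α a (α a + α b)) b 0 c =
      ∏ c ∈ (Finset.univ.erase a).erase b, x c ^ α c := by
    refine Finset.prod_congr rfl fun c hc => ?_
    obtain ⟨hcb, hc'⟩ := Finset.mem_erase.mp hc
    obtain ⟨hca, -⟩ := Finset.mem_erase.mp hc'
    rw [Function.update_of_ne hcb, Function.update_of_ne hca]
  rw [hrest]
  simp only [Function.update_self, Function.update_of_ne hab, pow_zero, one_mul]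
  rw [pow_add, div_pow]
  field_simp

end Monomials

end Literature.AlgebraicGeometry.Resolution
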